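import Summits.CriticalPhenomena.PercolationContinuityZ3.Theorems.SahiMasterFamilyShrunkFrames
import Summits.CriticalPhenomena.PercolationContinuityZ3.Theorems.SahiMasterFamilyShrunkFramePairwise

/-!
# Zero analysis of the shrunk-frame identities at order four (input of the (EQ-5) half of the order-five step)

Unit `prim-master-conj` (crux anchor stmt-CriticalPhenomena-4575); companion of `SahiMasterFamilyShrunkFrames.lean`,
`SahiMasterFamilyShrunkFramePairwise.lean` and `SahiMasterFamilyFourStep.lean`.  Peeling the order-five step
`E_5(U) = Σ_l E_4(U_{−m} with U_l ↦ U_l ∩ U_m)` (`sahiE_ind_step`) at the free slot produces the two order-four shrunk-frame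
families of K4-NOTES §11 of the unit; their positivity is in the tree.  Here we do the ZERO ANALYSIS (interior `p`): if such an
`E_4` vanishes then the family contains a `Z_3` sub-triple —
* `zeroFlagTriple_of_pairwise_shrink_eq_zero`: `E_4(D, K, X', Y) = 0` (frame `(K_D, K, Y)`, `D = K_D ∖ N_D` with `N_D` killing
  the pairwise products of `K, X', Y`) forces `(D, K, Y) ∈ Z_3` (`N_D = ∅`) or `(K, X', Y) ∈ Z_3`;
* `zeroFlagTriple_of_two_shrinks_eq_zero`: `E_4(G, D, X', Y) = 0` (frame `(Y, K, K')`, `G = K ∖ N`, `D = K' ∖ N'`, `N, N'` missing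
  `X'` and `Y`) forces one of `(G, D, Y)`, `(G, X', Y)`, `(D, X', Y)`, `(X', Y, G)` to lie in `Z_3`
— so that `sahiE_four_ind_eq_zero_iff_of_zeroFlagTriple` turns `E_4 = 0` into `Z_4`.  Packaged for a family `U : Fin 4 → _`
carrying the named events at four distinct slots: `nonneg_and_zeroFlag_of_pairwise_shrink_at`, `nonneg_and_zeroFlag_of_two_shrinks_at`
(`0 ≤ E_4(U)` and `E_4(U) = 0 → U ∈ Z_4`).  Slot plumbing: a family with an empty member is a zero flag at every order
(`suppZeroFlag_of_mem_empty`); `Z_3` of a `Fin 3` family from `Z_3` of its members listed in any order (`suppZeroFlag_three_of_vec_at`);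
the deleted family `U_{−m}` of a `Fin 4` family is in `Z_3` as soon as the three other members are (`suppZeroFlag_three_succAbove_of_vec`).
Everything proved; axioms standard. [this work]
-/

noncomputable section

open scoped Classical

namespace Summit.CriticalPhenomena.PercolationContinuityZ3.Theorems

open Finset Function MeasureTheory
open Literature.Combinatorics.Sahi2008
open Literature.Probability.Percolation (DeterminedBy)
open Literature.Probability.LatticeModels (prodBernoulli)
open Literature.Probability.LatticeModels.Kahn2022 (Affects real_pos_of_nonempty)
open Literature.Probability.Percolation.DecisionTree (ind ind_of_mem ind_of_not_mem ind_nonneg)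

/-! ### Slot plumbing -/

section Slots

variable {ι : Type*} [Fintype ι]

/-- **A family with an empty member is a zero flag** (every order `k + 1`): peel any other slot; every deleted and every modified
family still contains the empty member. [this work] -/
theorem suppZeroFlag_of_mem_empty :
    ∀ (k : ℕ) (U : Fin (k + 1) → Set (Set ι)) (j : Fin (k + 1)), U j = ∅ → SuppZeroFlag (k + 1) U
  | 0, U, j, hj => by
    have : j = 0 := Fin.eq_zero j
    subst this
    exact hj
  | 1, U, j, hj => by
    rw [suppZeroFlag_two_eta]
    rcases Fin.exists_fin_two.1 ⟨j, rfl⟩ with h | h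
    · rw [h] at hj; rw [hj]; exact suppZeroFlag_two_empty_left _
    · rw [h] at hj; rw [hj]; exact suppZeroFlag_two_symm (suppZeroFlag_two_empty_left _)
  | k + 2, U, j, hj => by
    have hji : j ≠ j.succAbove 0 := (Fin.succAbove_ne j 0).symm
    obtain ⟨z, hz⟩ := Fin.exists_succAbove_eq hji
    refine ⟨j.succAbove 0, suppZeroFlag_of_mem_empty (k + 1) _ z ?_, fun l => suppZeroFlag_of_mem_empty (k + 1) _ z ?_⟩
    · show U ((j.succAbove 0).succAbove z) = ∅
      rw [hz, hj]
    · by_cases hl : z = l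
      · subst hl
        rw [update_self, hz, hj, Set.empty_inter]
      · rw [update_of_ne hl]
        show U ((j.succAbove 0).succAbove z) = ∅
        rw [hz, hj]

omit [Fintype ι] in
/-- **`Z_3` of a `Fin 3` family from its three members listed in any order.** [this work] -/
theorem suppZeroFlag_three_of_vec_at (V : Fin 3 → Set (Set ι)) (a b c : Fin 3) (hab : a ≠ b) (hac : a ≠ c) (hbc : b ≠ c)
    (h : SuppZeroFlag 3 ![V a, V b, V c]) : SuppZeroFlag 3 V := by
  rcases (suppZeroFlag_three_iff_zVia _ _ _).1 h with h | h | h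
  · exact suppZeroFlag_three_of_zVia_at V b c a hbc hab.symm hac.symm h
  · exact suppZeroFlag_three_of_zVia_at V a c b hac hab hbc.symm h
  · exact suppZeroFlag_three_of_zVia_at V a b c hab hac hbc h

omit [Fintype ι] in
/-- **The deleted family `U_{−m}` of a `Fin 4` family is in `Z_3` when the three members other than `U m` are** (listed in any
order). [this work] -/
theorem suppZeroFlag_three_succAbove_of_vec (U : Fin 4 → Set (Set ι)) (m a b c : Fin 4) (ha : a ≠ m) (hb : b ≠ m)
    (hc : c ≠ m) (hab : a ≠ b) (hac : a ≠ c) (hbc : b ≠ c) (h : SuppZeroFlag 3 ![U a, U b, U c]) :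
    SuppZeroFlag 3 (fun j => U (m.succAbove j)) := by
  obtain ⟨a', ha'⟩ := Fin.exists_succAbove_eq ha
  obtain ⟨b', hb'⟩ := Fin.exists_succAbove_eq hb
  obtain ⟨c', hc'⟩ := Fin.exists_succAbove_eq hc
  refine suppZeroFlag_three_of_vec_at _ a' b' c' ?_ ?_ ?_ ?_
  · rintro rfl; exact hab (ha'.symm.trans hb')
  · rintro rfl; exact hac (ha'.symm.trans hc')
  · rintro rfl; exact hbc (hb'.symm.trans hc')
  · show SuppZeroFlag 3 ![U (m.succAbove a'), U (m.succAbove b'), U (m.succAbove c')]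
    rw [ha', hb', hc']
    exact h

end Slots

/-! ### Small analytic facts -/

section Analytic

variable {α : Type*} [Fintype α]

/-- `E_3` along a concrete permutation of the slots. [this work] -/
theorem sahiE_three_of_perm (μ : α → ℝ) (f g : Fin 3 → α → ℝ) (σ : Equiv.Perm (Fin 3)) (h : ∀ j, g j = f (σ j)) :
    sahiE μ 3 g = sahiE μ 3 f := by
  have : g = fun j => f (σ j) := funext h
  rw [this, sahiE_comp_perm]

variable {ι : Type} [Fintype ι]

/-- `E_2(1_A, 1_B) = P(A ∩ B) − P(A)P(B)` (events form of the covariance). [folklore] -/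
theorem sahiE_two_ind (p : ι → unitInterval) (A B : Set (Set ι)) :
    sahiE (bernoulliWeight p) 2 ![ind A, ind B] =
      (prodBernoulli p).real (A ∩ B) - (prodBernoulli p).real A * (prodBernoulli p).real B := by
  have hmul : ind A * ind B = ind (A ∩ B) := by
    funext ω; exact (Literature.Probability.Percolation.BHK2006.ind_inter A B ω).symm
  rw [sahiE_two, hmul, ex_bernoulliWeight_ind, ex_bernoulliWeight_ind, ex_bernoulliWeight_ind]

/-- **Strict Harris, `E_2` form**: in the open cube, `E_2(1_A, 1_B) = 0` for increasing `A, B` forces disjoint essential supports.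
[this work] -/
theorem disjoint_esupp_of_sahiE_two_eq_zero (p : ι → unitInterval) (hp : ∀ e, (p e : ℝ) ∈ Set.Ioo (0 : ℝ) 1)
    {A B : Set (Set ι)} (hA : IsUpperSet A) (hB : IsUpperSet B) (h : sahiE (bernoulliWeight p) 2 ![ind A, ind B] = 0) :
    Disjoint (esupp A) (esupp B) :=
  disjoint_esupp_of_real_inter_eq p hp hA hB (by rw [sahiE_two_ind] at h; linarith)

/-- A nonempty event has positive mass in the open cube (`ex` form). [folklore] -/
theorem ex_ind_pos_of_nonempty (p : ι → unitInterval) (hp : ∀ e, (p e : ℝ) ∈ Set.Ioo (0 : ℝ) 1) {N : Set (Set ι)}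
    (hN : N.Nonempty) : 0 < ex (bernoulliWeight p) (ind N) := by
  rw [ex_bernoulliWeight_ind]
  exact real_pos_of_nonempty p (fun e => Set.mem_Ioo.1 (hp e)) hN

/-- `E_3(L, X', Y) ≥ 0` for an independent pair `(L, Y)` and arbitrary increasing `X'`. [this work] -/
theorem sahiE_three_vec_nonneg_mid (p : ι → unitInterval) {L X' Y : Set (Set ι)} (hL : IsUpperSet L) (hX : IsUpperSet X')
    (hY : IsUpperSet Y) (dLY : Disjoint (esupp L) (esupp Y)) :
    0 ≤ sahiE (bernoulliWeight p) 3 ![ind L, ind X', ind Y] := by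
  rw [sahiE_three_of_perm (bernoulliWeight p) ![ind X', ind L, ind Y] ![ind L, ind X', ind Y] (Equiv.swap 0 1)
    fun j => by fin_cases j <;> rfl]
  exact sahiE_three_vec_nonneg p hX hL hY dLY

/-- `(L, X', Y) ∈ Z_3` from `E_3(L, X', Y) = 0` for an independent pair `(L, Y)` (interior `p`). [this work] -/
theorem suppZeroFlag_three_of_sahiE_eq_zero_mid (p : ι → unitInterval) (hp : ∀ e, (p e : ℝ) ∈ Set.Ioo (0 : ℝ) 1)
    {L X' Y : Set (Set ι)} (hL : IsUpperSet L) (hX : IsUpperSet X') (hY : IsUpperSet Y)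
    (dLY : Disjoint (esupp L) (esupp Y)) (h : sahiE (bernoulliWeight p) 3 ![ind L, ind X', ind Y] = 0) :
    SuppZeroFlag 3 ![L, X', Y] := by
  have hU3 : ∀ j, IsUpperSet ((![L, X', Y] : Fin 3 → Set (Set ι)) j) := by
    intro j; fin_cases j
    · exact hL
    · exact hX
    · exact hY
  have e : (fun j => ind ((![L, X', Y] : Fin 3 → Set (Set ι)) j)) = ![ind L, ind X', ind Y] := by
    funext j; fin_cases j <;> rfl
  have hpair : SuppZeroFlag 2 (fun j => (![L, X', Y] : Fin 3 → Set (Set ι)) ((1 : Fin 3).succAbove j)) := by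
    have e2 : (fun j => (![L, X', Y] : Fin 3 → Set (Set ι)) ((1 : Fin 3).succAbove j)) = ![L, Y] := by
      funext j; fin_cases j <;> rfl
    rw [e2]; exact (suppZeroFlag_two_iff hL hY).2 dLY
  exact (sahiE_three_ind_eq_zero_iff_of_indepPair p hp ![L, X', Y] hU3 1 hpair).1 (by rw [e]; exact h)

/-- `E_4(A, B, X', Y) ≥ 0` for an independent frame `(A, B, Y)` and arbitrary increasing `X'` in slot `2`. [this work] -/
theorem sahiE_four_vec_nonneg_mid (p : ι → unitInterval) {A B X' Y : Set (Set ι)} (hA : IsUpperSet A) (hB : IsUpperSet B)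
    (hX : IsUpperSet X') (hY : IsUpperSet Y) (dAB : Disjoint (esupp A) (esupp B)) (dAY : Disjoint (esupp A) (esupp Y))
    (dBY : Disjoint (esupp B) (esupp Y)) : 0 ≤ sahiE (bernoulliWeight p) 4 ![ind A, ind B, ind X', ind Y] := by
  rw [sahiE_four_of_perm (bernoulliWeight p) ![ind A, ind X', ind B, ind Y] ![ind A, ind B, ind X', ind Y] (Equiv.swap 1 2)
    fun j => by fin_cases j <;> rfl]
  exact sahiE_four_vec_nonneg p hA hX hB hY dBY dAB dAY

end Analytic

/-! ### Zero analysis of the two shrunk-frame identities -/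

section Zeros

variable {ι : Type} [Fintype ι]

/-- **Zero analysis, one pairwise-shrunk slot.**  In the setting of `sahiE_four_ind_nonneg_of_pairwise_shrink` (frame `(K_D, K, Y)` of
pairwise disjoint essential supports, `X'` increasing, `D ⊆ K_D` containing `X' ∩ Y ∩ K_D`, `X' ∩ K ∩ K_D`, `Y ∩ K ∩ K_D`), for `p` in the
open cube: `E_4(D, K, X', Y) = 0` forces `(D, K, Y) ∈ Z_3` (indeed `D = K_D`) or `(K, X', Y) ∈ Z_3`. [this work] -/
theorem zeroFlagTriple_of_pairwise_shrink_eq_zero (p : ι → unitInterval) (hp : ∀ e, (p e : ℝ) ∈ Set.Ioo (0 : ℝ) 1)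
    {D KD K X' Y : Set (Set ι)} (hKD : IsUpperSet KD) (hK : IsUpperSet K) (hX : IsUpperSet X') (hY : IsUpperSet Y)
    (dKDK : Disjoint (esupp KD) (esupp K)) (dKDY : Disjoint (esupp KD) (esupp Y)) (dKY : Disjoint (esupp K) (esupp Y))
    (hDKD : D ⊆ KD) (hXY : X' ∩ Y ∩ KD ⊆ D) (hXK : X' ∩ K ∩ KD ⊆ D) (hYK : Y ∩ K ∩ KD ⊆ D)
    (h0 : sahiE (bernoulliWeight p) 4 ![ind D, ind K, ind X', ind Y] = 0) :
    SuppZeroFlag 3 ![D, K, Y] ∨ SuppZeroFlag 3 ![K, X', Y] := by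
  have aXY := ind_mul_ind_mul_ind_diff_eq_zero hXY
  have aXK := ind_mul_ind_mul_ind_diff_eq_zero hXK
  have aYK := ind_mul_ind_mul_ind_diff_eq_zero hYK
  rw [sahiE_four_eq_of_pairwise_shrink (bernoulliWeight p) (ind D) (ind K) (ind X') (ind Y) (ind KD) (ind (KD \ D))
    (by rw [ind_diff_eq_sub hDKD]; ring) (by rw [mul_comm (ind K)]; exact aXK) (by rw [mul_comm (ind K)]; exact aYK) aXY] at h0
  have t1 := sahiE_four_vec_nonneg_mid p hKD hK hX hY dKDK dKDY dKY
  have t2 := sahiE_two_vec_nonneg p hX hY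
  have t3 := sahiE_two_vec_nonneg p hK hY
  have t4 := sahiE_two_vec_nonneg p hK hX
  have t5 := sahiE_three_vec_nonneg_mid p hK hX hY dKY
  have c1 := ex_ind_mul_nonneg p K (KD \ D)
  have c2 := ex_ind_mul_nonneg p X' (KD \ D)
  have c3 := ex_ind_mul_nonneg p Y (KD \ D)
  have c4 := ex_ind_nonneg' p (KD \ D)
  have m1 := mul_nonneg c1 t2; have m2 := mul_nonneg c2 t3; have m3 := mul_nonneg c3 t4; have m4 := mul_nonneg c4 t5
  by_cases hN : (KD \ D).Nonempty
  · right
    have c4pos := ex_ind_pos_of_nonempty p hp hN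
    have hprod : ex (bernoulliWeight p) (ind (KD \ D)) * sahiE (bernoulliWeight p) 3 ![ind K, ind X', ind Y] = 0 :=
      le_antisymm (by linarith) m4
    rcases mul_eq_zero.1 hprod with h | h
    · exact absurd h c4pos.ne'
    · exact suppZeroFlag_three_of_sahiE_eq_zero_mid p hp hK hX hY dKY h
  · left
    rw [Set.not_nonempty_iff_eq_empty, Set.sdiff_eq_empty] at hN
    rw [Set.Subset.antisymm hDKD hN]
    exact suppZeroFlag_three_of_disjoint hKD hK hY dKDK dKDY dKY

/-- **Zero analysis, two shrunk slots.**  In the setting of `sahiE_four_ind_nonneg_of_two_shrinks` (frame `(Y, K, K')` of pairwise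
disjoint essential supports, `X'` increasing, `G ⊆ K`, `D ⊆ K'` with `X' ∩ K ⊆ G ⊇ Y ∩ K`, `X' ∩ K' ⊆ D ⊇ Y ∩ K'`; here also `Y` nonempty), for `p` in the open cube: `E_4(G, D, X', Y) = 0` forces a `Z_3` sub-triple — `(G, D, Y)` (both
annihilators empty), `(G, X', Y)` (`G = K`), `(D, X', Y)` (`D = K'`), or `(X', Y, G)` (both nonempty: then `X' ⟂ Y` and
`(X', Y, G) ∈ Z_3` via `(X', Y)`). [this work] -/
theorem zeroFlagTriple_of_two_shrinks_eq_zero (p : ι → unitInterval) (hp : ∀ e, (p e : ℝ) ∈ Set.Ioo (0 : ℝ) 1)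
    {G D X' Y K K' : Set (Set ι)} (hX : IsUpperSet X') (hY : IsUpperSet Y) (hK : IsUpperSet K) (hK' : IsUpperSet K')
    (hYne : Y.Nonempty)
    (dYK : Disjoint (esupp Y) (esupp K)) (dYK' : Disjoint (esupp Y) (esupp K')) (dKK' : Disjoint (esupp K) (esupp K'))
    (hGK : G ⊆ K) (hDK' : D ⊆ K') (hXG : X' ∩ K ⊆ G) (hYG : Y ∩ K ⊆ G) (hXD : X' ∩ K' ⊆ D) (hYD : Y ∩ K' ⊆ D)
    (h0 : sahiE (bernoulliWeight p) 4 ![ind G, ind D, ind X', ind Y] = 0) :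
    SuppZeroFlag 3 ![G, D, Y] ∨ SuppZeroFlag 3 ![G, X', Y] ∨ SuppZeroFlag 3 ![D, X', Y] ∨ SuppZeroFlag 3 ![X', Y, G] := by
  have ann : ∀ {A B C : Set (Set ι)}, A ∩ B ⊆ C → ind A * ind (B \ C) = 0 := fun h =>
    ind_mul_ind_eq_zero_of_disjoint (Set.disjoint_left.2 fun ω hA hN => hN.2 (h ⟨hA, hN.1⟩))
  rw [sahiE_four_eq_of_two_shrinks (bernoulliWeight p) (ind G) (ind D) (ind X') (ind Y) (ind K) (ind K')
    (ind (K \ G)) (ind (K' \ D)) (by rw [ind_diff_eq_sub hGK]; ring) (by rw [ind_diff_eq_sub hDK']; ring)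
    (ann hXG) (ann hYG) (ann hXD) (ann hYD)] at h0
  have t1 := sahiE_four_vec_nonneg_mid p hK hK' hX hY dKK' dYK.symm dYK'.symm
  have t2 := sahiE_three_vec_nonneg_mid p hK' hX hY dYK'.symm
  have t3 := sahiE_three_vec_nonneg_mid p hK hX hY dYK.symm
  have t4 := sahiE_two_vec_nonneg p hX hY
  have cN := ex_ind_nonneg' p (K \ G)
  have cN' := ex_ind_nonneg' p (K' \ D)
  have cKN' := ex_ind_mul_nonneg p K (K' \ D)
  have cmono := ex_ind_mul_le_of_subset p (N := K \ G) (N' := K' \ D) (K' := K') Set.sdiff_subset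
  have cNN' := mul_nonneg cN cN'
  have hb : 0 ≤ ex (bernoulliWeight p) (ind K' * ind (K \ G)) + ex (bernoulliWeight p) (ind K * ind (K' \ D))
      + ex (bernoulliWeight p) (ind (K \ G)) * ex (bernoulliWeight p) (ind (K' \ D))
      - ex (bernoulliWeight p) (ind (K \ G) * ind (K' \ D)) := by linarith
  have m2 := mul_nonneg cN t2; have m3 := mul_nonneg cN' t3; have m4 := mul_nonneg hb t4
  -- each product vanishes
  have z2 : ex (bernoulliWeight p) (ind (K \ G)) * sahiE (bernoulliWeight p) 3 ![ind K', ind X', ind Y] = 0 :=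
    le_antisymm (by linarith) m2
  have z3 : ex (bernoulliWeight p) (ind (K' \ D)) * sahiE (bernoulliWeight p) 3 ![ind K, ind X', ind Y] = 0 :=
    le_antisymm (by linarith) m3
  have z4 : (ex (bernoulliWeight p) (ind K' * ind (K \ G)) + ex (bernoulliWeight p) (ind K * ind (K' \ D))
      + ex (bernoulliWeight p) (ind (K \ G)) * ex (bernoulliWeight p) (ind (K' \ D))
      - ex (bernoulliWeight p) (ind (K \ G) * ind (K' \ D))) * sahiE (bernoulliWeight p) 2 ![ind X', ind Y] = 0 :=
    le_antisymm (by linarith) m4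
  have hGeq : ¬ (K \ G).Nonempty → G = K := fun hN => by
    rw [Set.not_nonempty_iff_eq_empty, Set.sdiff_eq_empty] at hN
    exact Set.Subset.antisymm hGK hN
  have hDeq : ¬ (K' \ D).Nonempty → D = K' := fun hN' => by
    rw [Set.not_nonempty_iff_eq_empty, Set.sdiff_eq_empty] at hN'
    exact Set.Subset.antisymm hDK' hN'
  by_cases hN : (K \ G).Nonempty <;> by_cases hN' : (K' \ D).Nonempty
  · -- both annihilators nonempty: `X' ⟂ Y`, `(K, X', Y) ∈ Z_3`, hence `(X', Y, G) ∈ Z_3` via `(X', Y)`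
    right; right; right
    have cNpos := ex_ind_pos_of_nonempty p hp hN
    have cN'pos := ex_ind_pos_of_nonempty p hp hN'
    have hbpos : 0 < ex (bernoulliWeight p) (ind K' * ind (K \ G)) + ex (bernoulliWeight p) (ind K * ind (K' \ D))
        + ex (bernoulliWeight p) (ind (K \ G)) * ex (bernoulliWeight p) (ind (K' \ D))
        - ex (bernoulliWeight p) (ind (K \ G) * ind (K' \ D)) := by
      have := mul_pos cNpos cN'pos; linarith
    have e2 : sahiE (bernoulliWeight p) 2 ![ind X', ind Y] = 0 := by
      rcases mul_eq_zero.1 z4 with h | h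
      · exact absurd h hbpos.ne'
      · exact h
    have e3 : sahiE (bernoulliWeight p) 3 ![ind K, ind X', ind Y] = 0 := by
      rcases mul_eq_zero.1 z3 with h | h
      · exact absurd h cN'pos.ne'
      · exact h
    have dXY : Disjoint (esupp X') (esupp Y) := disjoint_esupp_of_sahiE_two_eq_zero p hp hX hY e2
    have zK : SuppZeroFlag 3 ![K, X', Y] := suppZeroFlag_three_of_sahiE_eq_zero_mid p hp hK hX hY dYK.symm e3
    have hXGK : X' ∩ G = X' ∩ K :=
      Set.Subset.antisymm (fun ω h => ⟨h.1, hGK h.2⟩) fun ω h => ⟨h.1, hXG h⟩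
    have hYGK : Y ∩ G = Y ∩ K :=
      Set.Subset.antisymm (fun ω h => ⟨h.1, hGK h.2⟩) fun ω h => ⟨h.1, hYG h⟩
    refine suppZeroFlag_three_of_Z ((suppZeroFlag_two_iff hX hY).2 dXY) ?_ ?_
    · rw [hXGK]
      exact (suppZeroFlag_two_iff (hX.inter hK) hY).2
        (Finset.disjoint_of_subset_left (esupp_inter_subset X' K) (Finset.disjoint_union_left.2 ⟨dXY, dYK.symm⟩))
    · rw [hYGK]
      refine (suppZeroFlag_two_iff hX (hY.inter hK)).2 ?_
      rcases (suppZeroFlag_three_iff_zVia K X' Y).1 zK with hz | hz | hz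
      · exact (suppZeroFlag_two_iff hX (hY.inter hK)).1 hz.2.2
      · have dKYX : Disjoint (esupp K) (esupp (Y ∩ X')) := (suppZeroFlag_two_iff hK (hY.inter hX)).1 hz.2.2
        have hsub : esupp X' ⊆ esupp (X' ∩ Y) := esupp_subset_esupp_inter hX hY hYne dXY
        have dKX : Disjoint (esupp K) (esupp X') := by
          refine Finset.disjoint_of_subset_right hsub ?_
          rw [Set.inter_comm]; exact dKYX
        exact Finset.disjoint_of_subset_right (esupp_inter_subset Y K) (Finset.disjoint_union_right.2 ⟨dXY, dKX.symm⟩)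
      · have dKYX : Disjoint (esupp (K ∩ Y)) (esupp X') := (suppZeroFlag_two_iff (hK.inter hY) hX).1 hz.2.1
        rw [Set.inter_comm]; exact dKYX.symm
  · -- `N ≠ ∅ = N'`: `D = K'` and `(K', X', Y) ∈ Z_3`
    right; right; left
    have cNpos := ex_ind_pos_of_nonempty p hp hN
    have e3 : sahiE (bernoulliWeight p) 3 ![ind K', ind X', ind Y] = 0 := by
      rcases mul_eq_zero.1 z2 with h | h
      · exact absurd h cNpos.ne'
      · exact h
    rw [hDeq hN']
    exact suppZeroFlag_three_of_sahiE_eq_zero_mid p hp hK' hX hY dYK'.symm e3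
  · -- `N = ∅ ≠ N'`: `G = K` and `(K, X', Y) ∈ Z_3`
    right; left
    have cN'pos := ex_ind_pos_of_nonempty p hp hN'
    have e3 : sahiE (bernoulliWeight p) 3 ![ind K, ind X', ind Y] = 0 := by
      rcases mul_eq_zero.1 z3 with h | h
      · exact absurd h cN'pos.ne'
      · exact h
    rw [hGeq hN]
    exact suppZeroFlag_three_of_sahiE_eq_zero_mid p hp hK hX hY dYK.symm e3
  · -- both empty: `(G, D, Y) = (K, K', Y)` is an independent frame
    left
    rw [hGeq hN, hDeq hN']
    exact suppZeroFlag_three_of_disjoint hK hK' hY dKK' dYK.symm dYK'.symm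

end Zeros

/-! ### Packaged for a `Fin 4` family carrying the named events at four distinct slots -/

section At

variable {ι : Type} [Fintype ι]

/-- **Pairwise-shrunk frame at named slots**: `0 ≤ E_4(U)` and `E_4(U) = 0 → U ∈ Z_4`, for a `Fin 4` family `U` whose members at the
distinct slots `a, b, c, d` are `D, K, X', Y` as in `sahiE_four_ind_nonneg_of_pairwise_shrink`. [this work] -/
theorem nonneg_and_zeroFlag_of_pairwise_shrink_at (p : ι → unitInterval) (hp : ∀ e, (p e : ℝ) ∈ Set.Ioo (0 : ℝ) 1)
    (U : Fin 4 → Set (Set ι)) (hU : ∀ j, IsUpperSet (U j)) (a b c d : Fin 4) (hab : a ≠ b) (hac : a ≠ c) (had : a ≠ d)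
    (hbc : b ≠ c) (hbd : b ≠ d) (hcd : c ≠ d) {D KD K X' Y : Set (Set ι)} (haD : U a = D) (hbK : U b = K) (hcX : U c = X')
    (hdY : U d = Y)
    (hE : sahiE (bernoulliWeight p) 4 (fun j => ind (U j)) = sahiE (bernoulliWeight p) 4 ![ind D, ind K, ind X', ind Y])
    (hKD : IsUpperSet KD) (hK : IsUpperSet K) (hX : IsUpperSet X') (hY : IsUpperSet Y)
    (dKDK : Disjoint (esupp KD) (esupp K)) (dKDY : Disjoint (esupp KD) (esupp Y)) (dKY : Disjoint (esupp K) (esupp Y))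
    (hDKD : D ⊆ KD) (hXY : X' ∩ Y ∩ KD ⊆ D) (hXK : X' ∩ K ∩ KD ⊆ D) (hYK : Y ∩ K ∩ KD ⊆ D) :
    0 ≤ sahiE (bernoulliWeight p) 4 (fun j => ind (U j)) ∧
      (sahiE (bernoulliWeight p) 4 (fun j => ind (U j)) = 0 → SuppZeroFlag 4 U) := by
  refine ⟨by rw [hE]; exact sahiE_four_ind_nonneg_of_pairwise_shrink p hKD hK hX hY dKDK dKDY dKY hDKD hXY hXK hYK,
    fun h0 => ?_⟩
  have h0' := h0
  rw [hE] at h0'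
  rcases zeroFlagTriple_of_pairwise_shrink_eq_zero p hp hKD hK hX hY dKDK dKDY dKY hDKD hXY hXK hYK h0' with hz | hz
  · rw [← haD, ← hbK, ← hdY] at hz
    exact (sahiE_four_ind_eq_zero_iff_of_zeroFlagTriple p hp U hU c
      (suppZeroFlag_three_succAbove_of_vec U c a b d hac hbc hcd.symm hab had hbd hz)).1 h0
  · rw [← hbK, ← hcX, ← hdY] at hz
    exact (sahiE_four_ind_eq_zero_iff_of_zeroFlagTriple p hp U hU a
      (suppZeroFlag_three_succAbove_of_vec U a b c d hab.symm hac.symm had.symm hbc hbd hcd hz)).1 h0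

/-- **Two shrunk slots at named slots**: `0 ≤ E_4(U)` and `E_4(U) = 0 → U ∈ Z_4`, for a `Fin 4` family `U` whose members at the distinct
slots `a, b, c, d` are `G, D, X', Y` as in `sahiE_four_ind_nonneg_of_two_shrinks` (with `Y` nonempty). [this work] -/
theorem nonneg_and_zeroFlag_of_two_shrinks_at (p : ι → unitInterval) (hp : ∀ e, (p e : ℝ) ∈ Set.Ioo (0 : ℝ) 1)
    (U : Fin 4 → Set (Set ι)) (hU : ∀ j, IsUpperSet (U j)) (a b c d : Fin 4) (hab : a ≠ b) (hac : a ≠ c) (had : a ≠ d)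
    (hbc : b ≠ c) (hbd : b ≠ d) (hcd : c ≠ d) {G D X' Y K K' : Set (Set ι)} (haG : U a = G) (hbD : U b = D) (hcX : U c = X')
    (hdY : U d = Y)
    (hE : sahiE (bernoulliWeight p) 4 (fun j => ind (U j)) = sahiE (bernoulliWeight p) 4 ![ind G, ind D, ind X', ind Y])
    (hX : IsUpperSet X') (hY : IsUpperSet Y) (hK : IsUpperSet K) (hK' : IsUpperSet K')
    (hYne : Y.Nonempty) (dYK : Disjoint (esupp Y) (esupp K)) (dYK' : Disjoint (esupp Y) (esupp K'))
    (dKK' : Disjoint (esupp K) (esupp K')) (hGK : G ⊆ K) (hDK' : D ⊆ K') (hXG : X' ∩ K ⊆ G) (hYG : Y ∩ K ⊆ G)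
    (hXD : X' ∩ K' ⊆ D) (hYD : Y ∩ K' ⊆ D) :
    0 ≤ sahiE (bernoulliWeight p) 4 (fun j => ind (U j)) ∧
      (sahiE (bernoulliWeight p) 4 (fun j => ind (U j)) = 0 → SuppZeroFlag 4 U) := by
  refine ⟨by rw [hE]; exact sahiE_four_ind_nonneg_of_two_shrinks p hX hY hK hK' dYK dYK' dKK' hGK hDK' hXG hYG hXD hYD,
    fun h0 => ?_⟩
  have h0' := h0
  rw [hE] at h0'
  rcases zeroFlagTriple_of_two_shrinks_eq_zero p hp hX hY hK hK' hYne dYK dYK' dKK' hGK hDK' hXG hYG hXD hYD h0'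
    with hz | hz | hz | hz
  · rw [← haG, ← hbD, ← hdY] at hz
    exact (sahiE_four_ind_eq_zero_iff_of_zeroFlagTriple p hp U hU c
      (suppZeroFlag_three_succAbove_of_vec U c a b d hac hbc hcd.symm hab had hbd hz)).1 h0
  · rw [← haG, ← hcX, ← hdY] at hz
    exact (sahiE_four_ind_eq_zero_iff_of_zeroFlagTriple p hp U hU b
      (suppZeroFlag_three_succAbove_of_vec U b a c d hab hbc.symm hbd.symm hac had hcd hz)).1 h0
  · rw [← hbD, ← hcX, ← hdY] at hz
    exact (sahiE_four_ind_eq_zero_iff_of_zeroFlagTriple p hp U hU a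
      (suppZeroFlag_three_succAbove_of_vec U a b c d hab.symm hac.symm had.symm hbc hbd hcd hz)).1 h0
  · rw [← hcX, ← hdY, ← haG] at hz
    exact (sahiE_four_ind_eq_zero_iff_of_zeroFlagTriple p hp U hU b
      (suppZeroFlag_three_succAbove_of_vec U b c d a hbc.symm hbd.symm hab hcd hac.symm had.symm hz)).1 h0

end At

end Summit.CriticalPhenomena.PercolationContinuityZ3.Theorems
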